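import Summits.ResolutionOfSingularities.ResolutionOfSingularities.Theorems.FrobeniusLadderFRationalResolutionChartAlgebraFixedPoint
import HarnessLib

/-!
# Crux `FrobeniusLadder.FRationalResolution` (stmt-ResolutionOfSingularities-15317), line `redirect`,
# stub `stub_diagonalizableQuotientResolution` — **torus-fixed primes are MONOTONE along a log stratum: chains of
# stratum primes below `𝔭` lift to chains of fixed primes below `𝔓`** (brick of design C3 = the rank-2 stratum layer
# of the non-isolated case, memo MEMO-15317-leafhand2-g10 §2 (L2): the lower bound `dim C_𝔓/I(𝔓)C_𝔓 ≥ d` along a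
# stratum of dimension `d`)

Setting as in `…ChartAlgebraNormalForm` / `…ChartAlgebraFixedPoint`: a chart `φ : P → A`, a chart algebra
`C = A[χ(Q)]` (`χ : Q → C` extending `φ` along `P ≤ Q ⊆ ℤⁿ`), a prime `𝔭` of `A` with unit face `F_𝔭`, and the
fixed prime `𝔓` of `C` over `𝔭` (the prime over `𝔭` containing `χ(Q ∖ ℤF_𝔭)`, unique by
`…ChartAlgebraFixedPoint.eq_of_comap_eq_of_forall_mem`). The primes `𝔭' ⊆ 𝔭` of the STRATUM of `𝔭` are those
containing Kato's ideal `I(𝔭, φ) = (φ(P ∖ F_𝔭))`.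
* `faceMonoid_eq_of_le_of_ideal_le` — such `𝔭'` have the same unit face: `F_{𝔭'} = F_𝔭`;
* **`fixedPrime_le_of_le`** — the fixed prime over `𝔭'` lies inside the fixed prime over `𝔭` (membership in a fixed
  prime is `φ(f)x ∈ 𝔭'C + χ(Q ∖ ℤF)C`, `…mem_iff_exists_val_mul_mem_span`, monotone in `𝔭'`);
* `fixedPrime_ne_of_ne` — distinct stratum primes have distinct fixed primes;
* **`exists_fixedPrime_le_of_stratum`** — over a log regular point `𝔭'` of the stratum of `𝔭` there IS a fixed prime
  `𝔓' ⊆ 𝔓` over `𝔭'` (`…exists_isPrime_comap_eq_forall_mem_iff` at `𝔭'`, its hypotheses (S)/(H) transported along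
  `F_{𝔭'} = F_𝔭`). Hence every chain of stratum primes below `𝔭` lifts to a chain of primes of `C` between
  `I(𝔓, χ)C` and `𝔓`: the fixed STRATUM of the new chart dominates the base stratum (with
  `…FixedStratumResidue`: it is a closed subscheme of it), which is the dimension input of Kato's condition (2.1)
  at `𝔓` along a positive-dimensional stratum.

Honest label: generic local algebra toward ONE leaf stub (no stub, crux or summit closed). No definitions, no named
facts, no sorry. [cite: Kato1994, Def. (2.1), (7.3), (10.1)] [cite: Niziol2006, §4]
-/

noncomputable section

-- single-problem summit: the doubled namespace component is forced
set_option linter.dupNamespace false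

open IsLocalRing Literature.AlgebraicGeometry.Resolution Literature.AlgebraicGeometry.Resolution.LogChart
open Summit.ResolutionOfSingularities.ResolutionOfSingularities.Theorems.FRationalResolution.ChartAlgebraNormalForm
open Summit.ResolutionOfSingularities.ResolutionOfSingularities.Theorems.FRationalResolution.ChartAlgebraFixedPoint

namespace Summit.ResolutionOfSingularities.ResolutionOfSingularities.Theorems.FRationalResolution.FixedStratumChains

universe u

variable {A : Type u} [CommRing A] {n : ℕ} {P : AddSubmonoid (Fin n → ℤ)} {φ : Multiplicative P →* A}
  {𝔭 𝔭' : Ideal A} [𝔭.IsPrime] [𝔭'.IsPrime] {C : Type u} [CommRing C] [Algebra A C]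
  {Q : AddSubmonoid (Fin n → ℤ)} {χ : Multiplicative Q →* C} {𝔓 𝔓' : Ideal C} [𝔓.IsPrime] [𝔓'.IsPrime]

omit [𝔓.IsPrime] [𝔓'.IsPrime] in
/-- **Along a stratum the unit face is constant**: if `𝔭' ⊆ 𝔭` contains Kato's ideal `I(𝔭, φ) = (φ(P ∖ F_𝔭))`, then
`F_{𝔭'} = F_𝔭`. [cite: Kato1994, Def. (2.1), (7.3)] -/
theorem faceMonoid_eq_of_le_of_ideal_le (hle : 𝔭' ≤ 𝔭) (hI : ideal P φ 𝔭 ≤ 𝔭') :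
    faceMonoid P φ 𝔭' = faceMonoid P φ 𝔭 := by
  ext v
  simp only [mem_faceMonoid]
  constructor
  · rintro ⟨hv, h⟩
    refine ⟨hv, fun hv𝔭 => h (hI ?_)⟩
    rw [val_of_mem P φ hv] at hv𝔭 ⊢
    exact Ideal.subset_span ⟨⟨v, hv⟩, hv𝔭, rfl⟩
  · rintro ⟨hv, h⟩
    exact ⟨hv, fun hv𝔭' => h (hle hv𝔭')⟩

/-- **Fixed primes are monotone along the stratum.** Let `𝔭' ⊆ 𝔭` contain `I(𝔭, φ)`, let `𝔓'` be a prime of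
`C = A[χ(Q)]` over `𝔭'` containing `χ(Q ∖ ℤF_{𝔭'})` and `𝔓` a prime over `𝔭` containing `χ(Q ∖ ℤF_𝔭)`. Then
`𝔓' ⊆ 𝔓`. [cite: Kato1994, (10.1)] -/
theorem fixedPrime_le_of_le (hPQ : P ≤ Q)
    (hχ : ∀ p : P, χ (Multiplicative.ofAdd ⟨(p : Fin n → ℤ), hPQ p.2⟩) =
      algebraMap A C (φ (Multiplicative.ofAdd p)))
    (hgen : Algebra.adjoin A (Set.range χ) = ⊤) (hle : 𝔭' ≤ 𝔭) (hI : ideal P φ 𝔭 ≤ 𝔭')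
    (h𝔓' : 𝔓'.comap (algebraMap A C) = 𝔭')
    (hq' : ∀ q : Q, (q : Fin n → ℤ) ∉ Submodule.span ℤ (faceMonoid P φ 𝔭' : Set (Fin n → ℤ)) →
      χ (Multiplicative.ofAdd q) ∈ 𝔓')
    (h𝔓 : 𝔓.comap (algebraMap A C) = 𝔭)
    (hq : ∀ q : Q, (q : Fin n → ℤ) ∉ Submodule.span ℤ (faceMonoid P φ 𝔭 : Set (Fin n → ℤ)) →
      χ (Multiplicative.ofAdd q) ∈ 𝔓) :
    𝔓' ≤ 𝔓 := by
  have hF := faceMonoid_eq_of_le_of_ideal_le (P := P) (φ := φ) hle hI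
  intro x hx
  obtain ⟨f, hf, hmem⟩ := (mem_iff_exists_val_mul_mem_span (𝔭 := 𝔭') hPQ hχ hgen h𝔓' hq' x).1 hx
  -- the ideal `𝔭'C + χ(Q ∖ ℤF)C` lies in `𝔓`
  have hJ : Ideal.span ((algebraMap A C '' (𝔭' : Set A)) ∪ ((fun q : Q => χ (Multiplicative.ofAdd q)) ''
      {q : Q | (q : Fin n → ℤ) ∉ Submodule.span ℤ (faceMonoid P φ 𝔭' : Set (Fin n → ℤ))})) ≤ 𝔓 := by
    refine Ideal.span_le.2 ?_
    rintro _ (⟨π, hπ, rfl⟩ | ⟨q, hqL, rfl⟩)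
    · have : π ∈ 𝔓.comap (algebraMap A C) := by rw [h𝔓]; exact hle hπ
      exact this
    · rw [hF] at hqL
      exact hq q hqL
  have hfx : algebraMap A C (val P φ f) * x ∈ 𝔓 := hJ hmem
  have hfu : algebraMap A C (val P φ f) ∉ 𝔓 := by
    intro h
    have h' : val P φ f ∈ 𝔓.comap (algebraMap A C) := h
    rw [h𝔓] at h'
    rw [hF] at hf
    exact ((mem_faceMonoid P φ 𝔭).1 hf).2 h'
  exact (Ideal.IsPrime.mem_or_mem inferInstance hfx).resolve_left hfu

omit [𝔭.IsPrime] [𝔭'.IsPrime] [𝔓.IsPrime] [𝔓'.IsPrime] in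
/-- Distinct base primes have distinct fixed primes. [folklore] -/
theorem fixedPrime_ne_of_ne (hne : 𝔭' ≠ 𝔭) (h𝔓' : 𝔓'.comap (algebraMap A C) = 𝔭')
    (h𝔓 : 𝔓.comap (algebraMap A C) = 𝔭) : 𝔓' ≠ 𝔓 := by
  rintro rfl
  exact hne (h𝔓'.symm.trans h𝔓)

/-- **Existence of the fixed prime over a stratum point, inside `𝔓`.** Let `φ` be log regular at a prime `𝔭' ⊆ 𝔭`
containing `I(𝔭, φ)` (a point of the stratum of `𝔭`), and let `C = A[χ(Q)]` be a chart algebra with (D), (K) and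
the face conditions (S), (H) relative to `ℤF_𝔭`. If `𝔓` is a prime over `𝔭` containing `χ(Q ∖ ℤF_𝔭)`, then there
is a prime `𝔓' ⊆ 𝔓` over `𝔭'` whose chart non-units are exactly `χ(Q ∖ ℤF_𝔭)`; it is `≠ 𝔓` when `𝔭' ≠ 𝔭`.
[cite: Kato1994, (7.3), (10.1)] -/
theorem exists_fixedPrime_le_of_stratum [IsNoetherianRing A] (hP : P.FG)
    (hsat : ∀ (v : Fin n → ℤ) (k : ℕ), 0 < k → k • v ∈ P → v ∈ P)
    (hle : 𝔭' ≤ 𝔭) (hI : ideal P φ 𝔭 ≤ 𝔭') (hreg' : IsLogRegularAt P φ 𝔭')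
    (hPQ : P ≤ Q)
    (hχ : ∀ p : P, χ (Multiplicative.ofAdd ⟨(p : Fin n → ℤ), hPQ p.2⟩) =
      algebraMap A C (φ (Multiplicative.ofAdd p)))
    (hgen : Algebra.adjoin A (Set.range χ) = ⊤)
    (hD : ∀ q ∈ Q, ∃ p ∈ P, q + p ∈ P)
    (hK : ∀ a : A, algebraMap A C a = 0 → ∃ p : P, φ (Multiplicative.ofAdd p) * a = 0)
    (hS : ∀ q₁ ∈ Q, ∀ q₂ ∈ Q, q₁ + q₂ ∈ Submodule.span ℤ (faceMonoid P φ 𝔭 : Set (Fin n → ℤ)) →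
      q₁ ∈ Submodule.span ℤ (faceMonoid P φ 𝔭 : Set (Fin n → ℤ)))
    (hH : ∀ q ∈ Q, ∀ p ∈ P, q + p ∈ Submodule.span ℤ (faceMonoid P φ 𝔭 : Set (Fin n → ℤ)) →
      q ∈ Submodule.span ℤ (faceMonoid P φ 𝔭 : Set (Fin n → ℤ)))
    (h𝔓 : 𝔓.comap (algebraMap A C) = 𝔭)
    (hq : ∀ q : Q, (q : Fin n → ℤ) ∉ Submodule.span ℤ (faceMonoid P φ 𝔭 : Set (Fin n → ℤ)) →
      χ (Multiplicative.ofAdd q) ∈ 𝔓) :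
    ∃ 𝔓₁ : Ideal C, 𝔓₁.IsPrime ∧ 𝔓₁.comap (algebraMap A C) = 𝔭' ∧
      (∀ q : Q, χ (Multiplicative.ofAdd q) ∈ 𝔓₁ ↔
        (q : Fin n → ℤ) ∉ Submodule.span ℤ (faceMonoid P φ 𝔭 : Set (Fin n → ℤ))) ∧
      𝔓₁ ≤ 𝔓 ∧ (𝔭' ≠ 𝔭 → 𝔓₁ ≠ 𝔓) := by
  have hF := faceMonoid_eq_of_le_of_ideal_le (P := P) (φ := φ) hle hI
  have hS' : ∀ q₁ ∈ Q, ∀ q₂ ∈ Q, q₁ + q₂ ∈ Submodule.span ℤ (faceMonoid P φ 𝔭' : Set (Fin n → ℤ)) →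
      q₁ ∈ Submodule.span ℤ (faceMonoid P φ 𝔭' : Set (Fin n → ℤ)) := by
    rw [hF]; exact hS
  have hH' : ∀ q ∈ Q, ∀ p ∈ P, q + p ∈ Submodule.span ℤ (faceMonoid P φ 𝔭' : Set (Fin n → ℤ)) →
      q ∈ Submodule.span ℤ (faceMonoid P φ 𝔭' : Set (Fin n → ℤ)) := by
    rw [hF]; exact hH
  obtain ⟨𝔓₁, h𝔓₁, h𝔓₁A, h𝔓₁q, -, -⟩ :=
    exists_isPrime_comap_eq_forall_mem_iff (𝔭 := 𝔭') hP hsat hreg' hPQ hχ hgen hD hK hS' hH'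
  haveI := h𝔓₁
  have hq₁ : ∀ q : Q, (q : Fin n → ℤ) ∉ Submodule.span ℤ (faceMonoid P φ 𝔭' : Set (Fin n → ℤ)) →
      χ (Multiplicative.ofAdd q) ∈ 𝔓₁ := fun q hqL => (h𝔓₁q q).2 hqL
  refine ⟨𝔓₁, h𝔓₁, h𝔓₁A, fun q => ?_, fixedPrime_le_of_le hPQ hχ hgen hle hI h𝔓₁A hq₁ h𝔓 hq,
    fun hne => fixedPrime_ne_of_ne hne h𝔓₁A h𝔓⟩
  rw [h𝔓₁q q, hF]

end Summit.ResolutionOfSingularities.ResolutionOfSingularities.Theorems.FRationalResolution.FixedStratumChains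

end
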